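import Literature.MathematicalPhysics.QuantumFieldTheory.Balaban1983to89.BlockAveraging

/-!
# BalabanUVNodes ∕ N08 — THE READ SET OF THE (0.4) GUARD: the small-field condition `Small ℰ U c`, the correction factor `corr ℰ U c` and the averaged bond `Ū(c)` depend on the
# fine field ONLY through the bonds traversed by the loop words of `c` (and `c`'s straight segment) — bond-level locality, the interface the free-slot laundering theorems need

Track A, DAG node N08 ([Balaban1985UV3] Thm 1 p. 257 ∕ Thm 2 p. 272; averaging [Balaban1987RG1] (0.4) p. 253).  Cell `pub-ymgap`, seat `pub-ymgap-dag-n08-d` g47 (R529-ym summon;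
SPEC memo `N08-HJ-M3-SPEC-g47.md` (M3a)); `--supports stmt-QuantumFields-19936` (helper).

THE POINT.  (M3) of the hTop design asks which fine bonds the guard at a coarse bond `c` READS.  Block-level locality is in the tree (lit `BlockAveraging.loopHol_local` ∕
`avgFun_local`: bonds issuing from `B(c₋) ∪ B(c₊)`); the laundering theorems (✓p754299∕p754955∕p755310, px8 ✓p755566 `…FreeSlot.map_withDensity_axialAvg_eq_smul_of_readSet`) need the
BOND-level statement «`U = U′` on the read set ⇒ same guard, same correction, same `Ū(c)`», with the read set = the bonds of the loop words (lit `BlockAveraging.loopWord`, the staircases +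
transported bond + return staircase + the segment backwards).  This file states exactly that, with the read set left as the explicit `∀ i, ∀ s ∈ walk …` quantifier (no new `def`), so that
(M3b) — the census of WHICH straight-segment bonds are read (SPEC §1: c's own segment, the inner halves of the collinear and transverse neighbouring segments) — is pure lattice
arithmetic on `loopWord`'s letters.

CONTENTS ([folklore] over lit `BlockAveraging` ∕ `T4Continuum`; 0 `def`, 0 `sorry`): §1 `loopHol_congr_of_read` · `small_iff_of_read` · `corr_congr_of_read` · ★★ `avgFun_congr_of_read` (also needs
agreement on `c`'s segment `line c t`, `t < L` — which IS among the loop letters, but stated separately for the straight transporter); §2 `ne_of_blockOf_src_ne` (a bond issuing from a block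
other than `B(c₋)`, `B(c₊)` is unread), `blockOf_src_line_zero` ∕ `blockOf_src_line_last` (the first ∕ last bond of a segment issues from its centre ∕ target block), ★ `first_or_last_unread_of_blocks`
(every segment whose centre or target block avoids `c`'s two blocks has an unread END — the free slot the laundering theorems ask for; only `c` itself has both blocks in common).
HONEST: count-neutral helper; hTop ∕ (a)′∀ ∕ hJ NOT proved; N08 NOT discharged; R3 ≠ d = 4 ∕ mass gap ∕ Clay.
-/

noncomputable section

namespace Summit.QuantumFields.YangMills.Theorems.BalabanUVNodesN08GuardReadSet

open Literature.MathematicalPhysics.QuantumFieldTheory.Balaban1983to89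
open Literature.MathematicalPhysics.QuantumFieldTheory.Balaban1983to89.T4Continuum
open Literature.MathematicalPhysics.QuantumFieldTheory.Balaban1983to89.AveragingRT
open Literature.MathematicalPhysics.QuantumFieldTheory.Balaban1983to89.BlockAveraging

variable {P : Params} {j : ℕ} {G : Type*} [GaugeGroup G] (ℰ : LoopAverage G)

/-- **The loop variables of `c` read only the loop words' bonds**: if `U` and `U′` agree on every bond traversed by every loop word of `c`, the loop families coincide
(`T4ReflectionCone.holAt_congr`). [cite: Balaban1987RG1, (0.4) p.253] -/
theorem loopHol_congr_of_read {U U' : GaugeField P j G} (c : PBond P (j + 1))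
    (h : ∀ (i : Idx P), ∀ s ∈ walk (emb c.src) (loopWord P.L c.dir (off i.1) i.2.1 i.2.2), U s.bond = U' s.bond) :
    loopHol U c = loopHol U' c :=
  funext fun i => T4ReflectionCone.holAt_congr fun s hs => h i s hs

/-- **The small-field guard reads only the loop words' bonds.** [cite: Balaban1987RG1, (0.4) p.253] -/
theorem small_iff_of_read {U U' : GaugeField P j G} (c : PBond P (j + 1))
    (h : ∀ (i : Idx P), ∀ s ∈ walk (emb c.src) (loopWord P.L c.dir (off i.1) i.2.1 i.2.2), U s.bond = U' s.bond) :
    BlockAveraging.Small ℰ U c ↔ BlockAveraging.Small ℰ U' c := by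
  unfold BlockAveraging.Small
  rw [loopHol_congr_of_read c h]

/-- **The correction factor reads only the loop words' bonds.** [cite: Balaban1987RG1, (0.4) p.253] -/
theorem corr_congr_of_read {U U' : GaugeField P j G} (c : PBond P (j + 1))
    (h : ∀ (i : Idx P), ∀ s ∈ walk (emb c.src) (loopWord P.L c.dir (off i.1) i.2.1 i.2.2), U s.bond = U' s.bond) :
    corr ℰ U c = corr ℰ U' c := by
  unfold corr
  rw [loopHol_congr_of_read c h]
  by_cases hs : BlockAveraging.Small ℰ U' c
  · rw [if_pos ((small_iff_of_read ℰ c h).mpr hs), if_pos hs]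
  · rw [if_neg (fun h' => hs ((small_iff_of_read ℰ c h).mp h')), if_neg hs]

/-- The straight transporter of `c` reads only `c`'s segment `line c t`, `t < L`. [cite: Balaban1984PropagatorsI, (1.7) p.18] -/
theorem axialAvg_congr_of_read_line {U U' : GaugeField P j G} (c : PBond P (j + 1)) (h : ∀ t, t < P.L → U (line c t) = U' (line c t)) :
    axialAvg U c = axialAvg U' c := by
  have key : ∀ n, n ≤ P.L → pathProd U c n = pathProd U' c n := by
    intro n hn
    induction n with
    | zero => rfl
    | succ n ih => rw [pathProd, pathProd, ih (by omega), h n (by omega)]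
  exact key P.L le_rfl

/-- ★★ **THE AVERAGED BOND `Ū(c) = corr · U(c)` READS ONLY THE LOOP WORDS' BONDS AND `c`'S SEGMENT.** [cite: Balaban1987RG1, (0.4) p.253] -/
theorem avgFun_congr_of_read {U U' : GaugeField P j G} (c : PBond P (j + 1))
    (h : ∀ (i : Idx P), ∀ s ∈ walk (emb c.src) (loopWord P.L c.dir (off i.1) i.2.1 i.2.2), U s.bond = U' s.bond)
    (hline : ∀ t, t < P.L → U (line c t) = U' (line c t)) :
    avgFun ℰ U c = avgFun ℰ U' c := by
  show corr ℰ U c * axialAvg U c = corr ℰ U' c * axialAvg U' c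
  rw [corr_congr_of_read ℰ c h, axialAvg_congr_of_read_line c hline]

/-! ## §2 The blocks of the read set and the end bonds of the other segments (first (M3b) tools) -/

/-- **A bond issuing from a block other than `B(c₋)`, `B(c₊)` is NOT read by the guard of `c`** (lit `BlockAveraging.blockOf_src_of_mem_walk`, contraposed).
[cite: Balaban1987RG1, (0.4) p.253] -/
theorem ne_of_blockOf_src_ne (hj : j + 1 ≤ P.m + P.K) (c : PBond P (j + 1)) {b : PBond P j}
    (hb : blockOf b.src ≠ c.src) (hb' : blockOf b.src ≠ c.tgt) :
    ∀ (i : Idx P), ∀ s ∈ walk (emb c.src) (loopWord P.L c.dir (off i.1) i.2.1 i.2.2), s.bond ≠ b := by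
  intro i s hs hsb
  rcases blockOf_src_of_mem_walk hj c i s hs with h | h
  · exact hb (hsb ▸ h)
  · exact hb' (hsb ▸ h)

/-- The FIRST bond of the segment of `c′` issues from the centre block `B(c′₋)`. [folklore] -/
theorem blockOf_src_line_zero (hj : j + 1 ≤ P.m + P.K) (c' : PBond P (j + 1)) : blockOf (line c' 0).src = c'.src := by
  show blockOf (lineSite c' 0) = c'.src
  rw [lineSite_zero, Site.blockOf_emb hj]

/-- The LAST bond of the segment of `c′` issues from the target block `B(c′₊)` (`L` odd `≥ 3`). [folklore] -/
theorem blockOf_src_line_last (hj : j + 1 ≤ P.m + P.K) (c' : PBond P (j + 1)) : blockOf (line c' (P.L - 1)).src = c'.tgt := by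
  have hL := P.hL.2
  obtain ⟨k, hk⟩ := P.hL.1
  show blockOf (lineSite c' (P.L - 1)) = c'.tgt
  rw [lineSite_eq_hi hj c' (t := P.L - 1) (by omega) (by omega), Site.blockOf_blockSite hj]

/-- ★ **EVERY OTHER SEGMENT HAS AN UNREAD END (block form)**: if the centre block of `c′` is neither end block of `c`, the FIRST bond of `c′` is not read by the guard of `c`; if the
target block of `c′` is neither end block of `c`, its LAST bond is not read.  (The remaining incidence cases — `c′` sharing BOTH end blocks with `c`, i.e. `c′ = c` on a torus of side
`≥ 3` — are the typer's torus arithmetic; SPEC §1.) [cite: Balaban1987RG1, (0.4) p.253] -/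
theorem first_or_last_unread_of_blocks (hj : j + 1 ≤ P.m + P.K) (c c' : PBond P (j + 1))
    (h : (c'.src ≠ c.src ∧ c'.src ≠ c.tgt) ∨ (c'.tgt ≠ c.src ∧ c'.tgt ≠ c.tgt)) :
    (∀ (i : Idx P), ∀ s ∈ walk (emb c.src) (loopWord P.L c.dir (off i.1) i.2.1 i.2.2), s.bond ≠ line c' 0) ∨
      (∀ (i : Idx P), ∀ s ∈ walk (emb c.src) (loopWord P.L c.dir (off i.1) i.2.1 i.2.2), s.bond ≠ line c' (P.L - 1)) := by
  rcases h with ⟨h1, h2⟩ | ⟨h1, h2⟩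
  · left
    exact ne_of_blockOf_src_ne hj c (by rw [blockOf_src_line_zero hj]; exact h1) (by rw [blockOf_src_line_zero hj]; exact h2)
  · right
    exact ne_of_blockOf_src_ne hj c (by rw [blockOf_src_line_last hj]; exact h1) (by rw [blockOf_src_line_last hj]; exact h2)

end Summit.QuantumFields.YangMills.Theorems.BalabanUVNodesN08GuardReadSet

end
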